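import Summits.SmoothPoincare4.SmoothPoincare4.Theorems.ConvexBisectionAcyclicBisectionExistsChartedChainCycle
import Summits.SmoothPoincare4.SmoothPoincare4.Theorems.ConvexBisectionAcyclicBisectionExistsChartedChainSheets
import Summits.SmoothPoincare4.SmoothPoincare4.Theorems.ConvexBisectionAcyclicBisectionExistsChartedChainChordSign
import HarnessLib

/-!
# The rotated cores of the charted vanishing cycle have the shadows of the `A_{2g}` chain
(wave 4, brick Y4-3c of the model chain (R2) `exists_charted_chain` for the missing lemma
`crossingNumber_eq_stdSymp` of node N1a of stub `stub_modelsOnFibred_of_reach` = NF4, line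
`modp-braid-orbits`, crux `ConvexBisection.AcyclicBisectionExists`, item stmt-SmoothPoincare4-10508;
registered sub-goal `helper_shadow_baseRot_cycleCore`)

Let `b` be the core circle of the annulus chart `cycleChart` of the vanishing cycle of `page g c`
over the symmetric chord `[ζ_{2g}, ζ_0]` (`…ChartedChainCycle.lean`), and `baseRot g (j+1)` the
cyclic symmetry (`…ChartedChainSymmetry.lean`).  **`shadow (baseRot g (j+1) ∘ b) = chainVec g j`**
for `j < 2g` (`helper_shadow_baseRot_cycleCore`).  Three moves, all inside `Base g`:

* §1–2 FAMILY A (shrink the Joukowski radius `radP 0 → 1` at fixed page `c`): the rotated core is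
  freely homotopic to the rotated Joukowski image of the unit circle, which passes through the
  branch points of the page (`coreFamAmb`, `shadow_eq_coreFam`);
* §3 ROTATE the parameter by half a turn (`shadow_eq_of_rotate`): in the shifted phase the
  Joukowski image of the unit circle is a SHEET LOOP over `ω^{j+1} · (m − iσ cos 2πu)` — upper
  sheet first — by the sheet identification `jY_exp_shift` of `…ChartedChainChordSign.lean`;
* §4 FAMILY B (a sheet family of `…ChartedChainSheets.lean`: straighten `m − iσ cos 2πu` to the
  chord zig-zag and shrink the page scale `c → 0`): the end is the `j`-th chain loop
  (`ω^{j+1} · chordZig g (2g) = chordZig g j`), whose shadow is `chainVec g j` (Milnor).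

Everything is proved; no `sorry`.  References: J. Milnor, *Singular points of complex
hypersurfaces* (1968), §9, Thm. 9.1 [Milnor1968]; A. Hatcher, *Algebraic Topology* (2002), Thm. 2A.1
[HatcherAT2002].
-/

noncomputable section

set_option linter.dupNamespace false

open scoped Manifold ContDiff Topology ComplexConjugate Real
open Set Function Metric Complex
open Literature.Topology.FourManifolds Literature.Topology.FourManifolds.LefschetzBase
  Literature.Topology.FourManifolds.TorusKnotMilnor

namespace Summit.SmoothPoincare4.SmoothPoincare4.Theorems.AcyclicBisectionExists.ModpBraidOrbits

variable {g : ℕ} {c : ℂ}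

/-! ## §1 The shrinking family of Joukowski circles -/

/-- The shrinking parameter `shrinkT g s u = (1 + s (radP g 0 − 1)) e^{2πiu}`: the core circle at
`s = 1`, the unit circle at `s = 0`. [folklore] -/
def shrinkT (g : ℕ) (s u : ℝ) : ℂ := ((1 + s * (radP g 0 - 1) : ℝ) : ℂ) * Complex.exp (((2 * π * u : ℝ) : ℂ) * I)

/-- The radius of the shrinking circle lies in `[1, radP g 0]` for `s ∈ [0, 1]`. [folklore] -/
theorem shrink_radius_mem {s : ℝ} (hs : s ∈ Icc (0 : ℝ) 1) :
    1 ≤ 1 + s * (radP g 0 - 1) ∧ 1 + s * (radP g 0 - 1) ≤ radP g 0 := by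
  have h := one_lt_radP g 0
  constructor <;> nlinarith [hs.1, hs.2]

/-- `‖shrinkT s u‖ = 1 + s (radP 0 − 1)` for `s ∈ [0, 1]`. [folklore] -/
theorem norm_shrinkT {s : ℝ} (hs : s ∈ Icc (0 : ℝ) 1) (u : ℝ) : ‖shrinkT g s u‖ = 1 + s * (radP g 0 - 1) := by
  rw [shrinkT, norm_mul, Complex.norm_real, Complex.norm_exp_ofReal_mul_I, mul_one, Real.norm_eq_abs,
    abs_of_pos (by linarith [(shrink_radius_mem (g := g) hs).1])]

/-- `shrinkT s u ≠ 0` for `s ∈ [0, 1]`. [folklore] -/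
theorem shrinkT_ne_zero {s : ℝ} (hs : s ∈ Icc (0 : ℝ) 1) (u : ℝ) : shrinkT g s u ≠ 0 := fun h => by
  have := norm_shrinkT (g := g) hs u
  rw [h, norm_zero] at this
  linarith [(shrink_radius_mem (g := g) hs).1]

/-- The strip condition along the shrinking family. [folklore] -/
theorem strip_shrinkT (hg : 1 ≤ g) {s : ℝ} (hs : s ∈ Icc (0 : ℝ) 1) (u : ℝ) :
    Real.cos (branchAngle g 1) < (jX g (shrinkT g s u)).re := by
  obtain ⟨h1, h2⟩ := shrink_radius_mem (g := g) hs
  refine strip_of_norm_le hg (by rw [norm_shrinkT hs]; exact h1) ?_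
  rw [norm_shrinkT hs]; exact h2.trans (radP_le' g 0)

/-- `‖jX‖² < 16/9` along the shrinking family. [folklore] -/
theorem norm_jX_shrinkT_sq_lt (hg : 1 ≤ g) {s : ℝ} (hs : s ∈ Icc (0 : ℝ) 1) (u : ℝ) :
    ‖jX g (shrinkT g s u)‖ ^ 2 < 16 / 9 := by
  obtain ⟨h1, h2⟩ := shrink_radius_mem (g := g) hs
  have h := norm_jX_sq_le g (δ := 1 / 12) (t := shrinkT g s u) (by rw [norm_shrinkT hs]; exact h1)
    (by rw [norm_shrinkT hs]; exact h2.trans (radP_le_thirteen_twelfths hg 0)) (by norm_num)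
  linarith

/-- At `s = 1` the shrinking parameter is the chart parameter of the core. [folklore] -/
theorem shrinkT_one (g : ℕ) (u : ℝ) : shrinkT g 1 u = tParam g (u, 0) := by
  simp [shrinkT, tParam]

/-- At `s = 0` the shrinking parameter is the unit circle. [folklore] -/
theorem shrinkT_zero (g : ℕ) (u : ℝ) : shrinkT g 0 u = Complex.exp (((2 * π * u : ℝ) : ℂ) * I) := by
  simp [shrinkT]

/-- The shrinking parameter is `1`-periodic in `u`. [folklore] -/
theorem shrinkT_periodic (g : ℕ) (s u : ℝ) : shrinkT g s (u + 1) = shrinkT g s u := by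
  unfold shrinkT
  rw [show (((2 * π * (u + 1) : ℝ)) : ℂ) * I = ((2 * π * u : ℝ) : ℂ) * I + 2 * π * I by push_cast; ring,
    Complex.exp_add, Complex.exp_two_pi_mul_I, mul_one]

/-- The shrinking parameter is continuous. [folklore] -/
theorem continuous_shrinkT (g : ℕ) : Continuous (uncurry (shrinkT g)) := by
  unfold shrinkT; fun_prop

/-- **The ambient family A**: the rotated Joukowski circles of shrinking radius in the page `c`.
[folklore] -/
def coreFamAmb (g : ℕ) (c : ℂ) (k : ℕ) (s u : ℝ) : EuclideanSpace ℝ (Fin 4) :=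
  rotAmbL g k (pagePt g c (jX g (shrinkT g s u)) (jY g (shrinkT g s u)))

/-- Family A stays in the base. [folklore] -/
theorem rho_coreFamAmb_le (hg : 1 ≤ g) (hc : ‖c‖ ≤ 1) (k : ℕ) {s : ℝ} (hs : s ∈ Icc (0 : ℝ) 1) (u : ℝ) :
    rho g (coreFamAmb g c k s u) ≤ 1 / 4 := by
  rw [coreFamAmb, rho_rotAmbL]
  exact rho_pagePt_le hc (jY_sq hg (shrinkT_ne_zero hs u)) (norm_jX_shrinkT_sq_lt hg hs u)

/-- Family A is continuous on `[0, 1] × ℝ`. [folklore] -/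
theorem continuousOn_coreFamAmb (hg : 1 ≤ g) (c : ℂ) (k : ℕ) :
    ContinuousOn (uncurry (coreFamAmb g c k)) (Icc (0 : ℝ) 1 ×ˢ univ) := by
  intro p hp
  have hT : ContinuousWithinAt (uncurry (shrinkT g)) (Icc (0 : ℝ) 1 ×ˢ univ) p :=
    (continuous_shrinkT g).continuousWithinAt
  have hX : ContinuousWithinAt (fun q : ℝ × ℝ => jX g (uncurry (shrinkT g) q)) (Icc (0 : ℝ) 1 ×ˢ univ) p :=
    ContinuousAt.comp_continuousWithinAt (f := uncurry (shrinkT g))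
      (continuousAt_jX g (shrinkT_ne_zero hp.1 p.2)) hT
  have hY : ContinuousWithinAt (fun q : ℝ × ℝ => jY g (uncurry (shrinkT g) q)) (Icc (0 : ℝ) 1 ×ˢ univ) p :=
    ContinuousAt.comp_continuousWithinAt (f := uncurry (shrinkT g))
      (continuousAt_jY g (shrinkT_ne_zero hp.1 p.2) (strip_shrinkT hg hp.1 p.2)) hT
  unfold coreFamAmb pagePt
  exact (rotAmbL g k).continuous.continuousAt.comp_continuousWithinAt
    (continuous_mk.continuousAt.comp_continuousWithinAt
      ((continuousWithinAt_const.mul hX).prodMk (continuousWithinAt_const.mul hY)))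

/-! ## §2 The rotated core is homotopic to the rotated Joukowski unit circle -/

variable {b : sphere (0 : EuclideanSpace ℝ (Fin 2)) 1 → Base g}

/-- **Family A**: `shadow (baseRot k ∘ b) = shadow K₀` for a circle map `K₀` tracing the rotated
Joukowski image of the unit circle. [cite: HatcherAT2002, Thm. 2A.1] -/
theorem shadow_eq_coreFam (hg : 1 ≤ g) (hc : ‖c‖ ≤ 1) (hbu : ∀ u : ℝ, cycleChart hg hc (u, 0) = b (circlePt u))
    (k : ℕ) (hbk : Continuous (baseRot g k ∘ b)) :
    ∃ K₀ : sphere (0 : EuclideanSpace ℝ (Fin 2)) 1 → Base g, ∃ hK₀ : Continuous K₀,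
      (∀ u ∈ Icc (0 : ℝ) 1, (K₀ (circlePt u)).1 = coreFamAmb g c k 0 u) ∧
        shadow g (baseRot g k ∘ b) hbk = shadow g K₀ hK₀ := by
  -- the end loop and its descent to the circle
  have hL : ContinuousOn (fun u => toBase g (coreFamAmb g c k 0 u)) (Icc (0 : ℝ) 1) := by
    refine continuousOn_toBase_comp ?_ fun u _ => rho_coreFamAmb_le hg hc k ⟨le_rfl, zero_le_one⟩ u
    have h : ContinuousOn (uncurry (coreFamAmb g c k) ∘ fun u : ℝ => ((0 : ℝ), u)) (Icc (0 : ℝ) 1) :=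
      (continuousOn_coreFamAmb hg c k).comp (Continuous.continuousOn (by fun_prop))
        fun u _ => ⟨⟨le_rfl, zero_le_one⟩, mem_univ _⟩
    exact h
  have h01 : toBase g (coreFamAmb g c k 0 0) = toBase g (coreFamAmb g c k 0 1) := by
    congr 1; simp only [coreFamAmb]; rw [← shrinkT_periodic g 0 0, zero_add]
  obtain ⟨K₀, hK₀, hK₀u⟩ := exists_circleMap_of_loop _ hL h01
  refine ⟨K₀, hK₀, fun u hu => ?_, ?_⟩
  · rw [hK₀u u hu, toBase_val (rho_coreFamAmb_le hg hc k ⟨le_rfl, zero_le_one⟩ u)]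
  refine shadow_eq_of_loop_family hbk hK₀ (fun s u => toBase g (coreFamAmb g c k (1 - s) u)) ?_ ?_ ?_ ?_
  · refine continuousOn_toBase_comp ?_ fun p hp => rho_coreFamAmb_le hg hc k ⟨by linarith [hp.1.2], by linarith [hp.1.1]⟩ _
    have h : ContinuousOn (uncurry (coreFamAmb g c k) ∘ fun p : ℝ × ℝ => (1 - p.1, p.2))
        (Icc (0 : ℝ) 1 ×ˢ Icc (0 : ℝ) 1) :=
      (continuousOn_coreFamAmb hg c k).comp (Continuous.continuousOn (by fun_prop))
        fun p hp => ⟨⟨by linarith [hp.1.2], by linarith [hp.1.1]⟩, mem_univ _⟩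
    exact h
  · intro s _
    congr 1; simp only [coreFamAmb]; rw [← shrinkT_periodic g (1 - s) 0, zero_add]
  · intro u _
    apply Subtype.ext
    rw [toBase_val (rho_coreFamAmb_le hg hc k ⟨by norm_num, by norm_num⟩ u), sub_zero, comp_apply, ← hbu u,
      coreFamAmb, shrinkT_one]
    rfl
  · intro u hu
    rw [sub_self, hK₀u u hu]

/-! ## §3 Half a turn later the Joukowski unit circle is a sheet loop -/

/-- **`e^{2πi(t + 1/2)}` is the antipode of `e^{2πit}`.** [folklore] -/
theorem circlePt_add_half (t : ℝ) : (circlePt (t + 1 / 2)).1 = -(circlePt t).1 := by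
  have e : 2 * π * (t + 1 / 2) = 2 * π * t + π := by ring
  rw [circlePt_eq_circlePoint, circlePt_eq_circlePoint, e]
  ext i
  fin_cases i <;> simp [circlePoint, Real.cos_add_pi, Real.sin_add_pi]

/-- The antipodal re-parametrisation of a circle map. [folklore] -/
def halfTurn (K : sphere (0 : EuclideanSpace ℝ (Fin 2)) 1 → Base g) (θ : sphere (0 : EuclideanSpace ℝ (Fin 2)) 1) :
    Base g :=
  K ⟨-θ.1, by rw [mem_sphere_zero_iff_norm, norm_neg, ← mem_sphere_zero_iff_norm]; exact θ.2⟩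

/-- The half-turn of a continuous circle map is continuous. [folklore] -/
theorem continuous_halfTurn {K : sphere (0 : EuclideanSpace ℝ (Fin 2)) 1 → Base g} (hK : Continuous K) :
    Continuous (halfTurn K) :=
  hK.comp (Continuous.subtype_mk (continuous_neg.comp continuous_subtype_val) _)

/-- `halfTurn K (e^{2πit}) = K (e^{2πi(t + 1/2)})`. [folklore] -/
theorem halfTurn_circlePt (K : sphere (0 : EuclideanSpace ℝ (Fin 2)) 1 → Base g) (t : ℝ) :
    halfTurn K (circlePt t) = K (circlePt (t + 1 / 2)) := by
  unfold halfTurn; congr 1; apply Subtype.ext; rw [circlePt_add_half]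

/-- The shifted-phase `x`-coordinate `m − iσ cos (2πu)`, as the chord point `jX (e^{i(2πu+π)})`.
[folklore] -/
def xShift (g : ℕ) (u : ℝ) : ℂ := jX g (Complex.exp (((2 * π * u + π : ℝ) : ℂ) * I))

/-- Family A at `s = 0`, half a turn later, is the sheet loop over `ω^k · xShift`. [folklore] -/
theorem coreFamAmb_zero_shift (hg : 1 ≤ g) (c : ℂ) (k : ℕ) {u : ℝ} (hu : u ∈ Icc (0 : ℝ) 1) :
    coreFamAmb g c k 0 (u + 1 / 2) = sheetAmb g c u (rootU (2 * g + 1) ^ k * xShift g u) := by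
  have he : shrinkT g 0 (u + 1 / 2) = Complex.exp (((2 * π * u + π : ℝ) : ℂ) * I) := by
    rw [shrinkT_zero]; congr 1; push_cast; ring
  rw [coreFamAmb, he, jY_exp_shift hg hu, sheetAmb, halfSign, xShift, rotAmbL_apply, pagePt, pagePt,
    cx_mk, cy_mk, mul_pow, rootU_pow_pow (Nat.succ_ne_zero _), one_mul]
  congr 1; ring

/-- **Half a turn later**: `shadow K₀ = shadow K₁` for a circle map `K₁` tracing the sheet loop over
`ω^k · xShift`. [cite: HatcherAT2002, §1.1] -/
theorem shadow_eq_halfTurn (hg : 1 ≤ g) (c : ℂ) (k : ℕ) {K₀ : sphere (0 : EuclideanSpace ℝ (Fin 2)) 1 → Base g}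
    (hK₀ : Continuous K₀) (hK₀u : ∀ u ∈ Icc (0 : ℝ) 1, (K₀ (circlePt u)).1 = coreFamAmb g c k 0 u) :
    (∀ u ∈ Icc (0 : ℝ) 1, (halfTurn K₀ (circlePt u)).1 = sheetAmb g c u (rootU (2 * g + 1) ^ k * xShift g u)) ∧
      shadow g K₀ hK₀ = shadow g (halfTurn K₀) (continuous_halfTurn hK₀) := by
  refine ⟨fun u hu => ?_, (shadow_eq_of_rotate hK₀ (continuous_halfTurn hK₀) (1 / 2) (halfTurn_circlePt K₀)).symm⟩
  rw [halfTurn_circlePt, ← coreFamAmb_zero_shift hg c k hu]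
  by_cases h : u ≤ 1 / 2
  · exact hK₀u _ ⟨by linarith [hu.1], by linarith⟩
  · rw [show u + 1 / 2 = (u - 1 / 2) + 1 by ring, circlePt_add_one,
      hK₀u _ ⟨by linarith [not_le.1 h], by linarith [hu.2]⟩, coreFamAmb, coreFamAmb, shrinkT_periodic]

/-! ## §4 Family B: straighten to the chain loop -/

/-- `jX (e^{iπ}) = ζ_{2g} = η̄` and `jX (e^{0}) = jX (e^{2πi}) = ζ_0 = η`. [folklore] -/
theorem jX_exp_pi_and_zero (g : ℕ) :
    jX g (Complex.exp ((π : ℝ) * I)) = branchPt g (2 * g) ∧ jX g (Complex.exp ((0 : ℝ) * I)) = branchPt g 0 := by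
  constructor
  · rw [show 2 * g = 2 * g - 0 from rfl, branchPt_two_mul_sub (Nat.zero_le _), branchPt_zero_eq, jX_exp,
      Real.cos_pi, map_add, map_mul, Complex.conj_ofReal, Complex.conj_ofReal, Complex.conj_I]
    push_cast; ring
  · rw [jX_exp, Real.cos_zero, mul_one, branchPt_zero_eq]

/-- Values of `xShift` at `0`, `1/2`, `1`: `ζ_{2g}`, `ζ_0`, `ζ_{2g}`. [folklore] -/
theorem xShift_ends (g : ℕ) :
    xShift g 0 = branchPt g (2 * g) ∧ xShift g (1 / 2) = branchPt g 0 ∧ xShift g 1 = branchPt g (2 * g) := by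
  obtain ⟨hπ, h0⟩ := jX_exp_pi_and_zero g
  refine ⟨?_, ?_, ?_⟩
  · rw [xShift, ← hπ]; congr 2; push_cast; ring
  · rw [xShift, ← h0, show ((2 * π * (1 / 2) + π : ℝ) : ℂ) * I = ((0 : ℝ) : ℂ) * I + 2 * π * I by push_cast; ring,
      Complex.exp_add, Complex.exp_two_pi_mul_I, mul_one]
  · rw [xShift, ← hπ, show ((2 * π * 1 + π : ℝ) : ℂ) * I = ((π : ℝ) : ℂ) * I + 2 * π * I by push_cast; ring,
      Complex.exp_add, Complex.exp_two_pi_mul_I, mul_one]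

/-- `xShift` is continuous with values in the closed unit disc. [folklore] -/
theorem continuous_xShift (g : ℕ) : Continuous (xShift g) ∧ ∀ u, ‖xShift g u‖ ≤ 1 := by
  refine ⟨continuous_iff_continuousAt.2 fun u => ?_, fun u => norm_jX_exp_le g _⟩
  exact ContinuousAt.comp (f := fun u : ℝ => Complex.exp (((2 * π * u + π : ℝ) : ℂ) * I))
    (continuousAt_jX g (Complex.exp_ne_zero _)) (Continuous.continuousAt (by fun_prop))

/-- `ζ_{2g+1} = ζ_0`. [folklore] -/
theorem branchPt_two_mul_add_one (g : ℕ) : branchPt g (2 * g + 1) = branchPt g 0 := by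
  rw [show 2 * g + 1 = 0 + (2 * g + 1) by ring, branchPt_add_period]

/-- `(ω^k ζ_i)^{2g+1} + 1 = 0`. [folklore] -/
theorem rootU_pow_mul_branchPt_pow (g k i : ℕ) : (rootU (2 * g + 1) ^ k * branchPt g i) ^ (2 * g + 1) + 1 = 0 := by
  rw [mul_pow, rootU_pow_pow (Nat.succ_ne_zero _), one_mul, branchPt_pow, neg_add_cancel]

/-- **Sub-goal `helper_shadow_baseRot_cycleCore`** (Y4-3 of the model chain (R2) for node N1a of
NF4): the core `b` of the charted vanishing cycle of `page g c` over the symmetric chord, rotated by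
`baseRot g (j+1)`, has homology shadow `chainVec g j` (`j < 2g`, `g ≥ 1`, `‖c‖ ≤ 1`).
[cite: Milnor1968, Thm. 9.1] -/
theorem helper_shadow_baseRot_cycleCore : ∀ (g : ℕ) (c : ℂ) (hg : 1 ≤ g) (hc : ‖c‖ ≤ 1) (b : Metric.sphere (0 : EuclideanSpace ℝ (Fin 2)) 1 → Literature.Topology.FourManifolds.LefschetzBase.Base g), (∀ u : ℝ, Summit.SmoothPoincare4.SmoothPoincare4.Theorems.AcyclicBisectionExists.ModpBraidOrbits.cycleChart hg hc (u, 0) = b (Literature.Topology.FourManifolds.circlePt u)) → ∀ (j : ℕ) (_hj : j < 2 * g) (hbj : Continuous (Summit.SmoothPoincare4.SmoothPoincare4.Theorems.AcyclicBisectionExists.ModpBraidOrbits.baseRot g (j + 1) ∘ b)), Literature.Topology.FourManifolds.LefschetzBase.shadow g (Summit.SmoothPoincare4.SmoothPoincare4.Theorems.AcyclicBisectionExists.ModpBraidOrbits.baseRot g (j + 1) ∘ b) hbj = Literature.Topology.FourManifolds.LefschetzBase.chainVec g j := by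
  intro g c hg hc b hbu j hj hbj
  obtain ⟨K₀, hK₀, hK₀u, hA⟩ := shadow_eq_coreFam hg hc hbu (j + 1) hbj
  obtain ⟨hK₁u, hR⟩ := shadow_eq_halfTurn hg c (j + 1) hK₀ hK₀u
  obtain ⟨K₂, hK₂, hK₂u⟩ := exists_chainCircle g j
  rw [hA, hR, ← helper_shadow_sheetLoop_chain g j hj K₂ hK₂ hK₂u]
  symm
  obtain ⟨hxc, hx1⟩ := continuous_xShift g
  obtain ⟨hz0, hz1, hzh⟩ := chordZig_ends g (2 * g)
  obtain ⟨hs0, hsh, hs1⟩ := xShift_ends g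
  -- family B: `X s u = ω^{j+1} ((1 − s) chordZig g (2g) u + s xShift g u)`, scale `s c`
  refine shadow_eq_of_sheet_family hc (fun s => s) continuousOn_id (fun s hs => by rw [abs_of_nonneg hs.1]; exact hs.2)
    (fun s u => rootU (2 * g + 1) ^ (j + 1) * (((1 - s : ℝ) : ℂ) * chordZig g (2 * g) u + (s : ℂ) * xShift g u))
    ?_ ?_ ?_ ?_ ?_ hK₂ (continuous_halfTurn hK₀) ?_ ?_
  · exact Continuous.continuousOn (by
      have := continuous_chordZig g (2 * g)
      fun_prop)
  · intro s hs u hu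
    rw [norm_mul, norm_rootU_pow, one_mul]
    calc ‖((1 - s : ℝ) : ℂ) * chordZig g (2 * g) u + (s : ℂ) * xShift g u‖
        ≤ ‖((1 - s : ℝ) : ℂ) * chordZig g (2 * g) u‖ + ‖(s : ℂ) * xShift g u‖ := norm_add_le _ _
      _ ≤ (1 - s) * 1 + s * 1 := by
          rw [norm_mul, norm_mul, Complex.norm_real, Complex.norm_real, Real.norm_eq_abs, Real.norm_eq_abs,
            abs_of_nonneg (by linarith [hs.2]), abs_of_nonneg hs.1]
          have h1 := mul_le_mul_of_nonneg_left (norm_chordZig_le g (2 * g) hu) (by linarith [hs.2] : (0 : ℝ) ≤ 1 - s)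
          have h2 := mul_le_mul_of_nonneg_left (hx1 u) hs.1
          linarith
      _ = 1 := by ring
  · intro s _; rw [hz0, hz1, hs0, hs1]
  · intro s _
    rw [hz0, hs0, show ((1 - s : ℝ) : ℂ) * branchPt g (2 * g) + (s : ℂ) * branchPt g (2 * g) = branchPt g (2 * g) by
      push_cast; ring]
    exact rootU_pow_mul_branchPt_pow g _ _
  · intro s _
    rw [hzh, hsh, branchPt_two_mul_add_one, show ((1 - s : ℝ) : ℂ) * branchPt g 0 + (s : ℂ) * branchPt g 0 =
      branchPt g 0 by push_cast; ring]
    exact rootU_pow_mul_branchPt_pow g _ _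
  · intro u hu
    rw [hK₂u u hu]
    simp only [Complex.ofReal_zero, zero_mul, sub_zero, Complex.ofReal_one, one_mul, add_zero]
    rw [rootU_pow_mul_chordZig, show 2 * g + (j + 1) = j + (2 * g + 1) by ring, chordZig_add_period]
  · intro u hu
    rw [hK₁u u hu]
    simp

end Summit.SmoothPoincare4.SmoothPoincare4.Theorems.AcyclicBisectionExists.ModpBraidOrbits

end
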